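/-
Copyright: statement-level skeleton of a published paper (lit-balaban cell, Phase-2 proof seat p20, gen 3). No claims beyond
what the kernel checks below.
-/
import Literature.MathematicalPhysics.QuantumFieldTheory.Balaban1983to89.B3TriangleAlphaGain
import Literature.MathematicalPhysics.QuantumFieldTheory.Balaban1983to89.B3TorusRadialSums

/-!
# `Balaban1983to89.B3AlphaGainSummed` — T. Bałaban, *(Higgs)₂,₃ quantum fields in a finite volume. III. Renormalization*,
Commun. Math. Phys. **88** (1983) 411–445 [Balaban1983Higgs3], pp. 427/438/442/444: the degree-`+α` bounds of (3.19), (3.31),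
(3.34) SUMMED over the torus — the subtracted terms are `O(1)·s^{α}·s^{d}` (resp. `s^{2d}`) times the `L¹` norm of the remaining
leg, uniformly in the volume

statement-level skeleton of published theorems with citation tags; proofs where landed; nothing here is a claim about the Yang–Mills mass gap

PDF held: `paper:balaban1983-higgs-2-3-quantum-fields-finite-volume` (journal page = PDF page + 410); pp. 427, 438, 442, 444 read
on the ×2 renders `run/shared/lean/pub/pub-balaban/b2b-balaban-ref1/pages/1983-cmp88-higgs23-III/…-p017/p028/p032/p034-x2.png`.

CITATION HEADER (lean-in-tree rule).  lit-balaban PHASE 2, seat p20 (gen 3), rows **B3.Eq3.18-3.20**, **B3.Eq3.25-3.32**,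
**B3.Eq3.33-3.38** (owner r15, referee ref-4); completes `B3SubtractionAlphaGain` (p251191) and `B3TriangleAlphaGain` (p251607),
whose bounds keep the pointwise majorants `Σ_{x,x′}η^{2d}‖φ(x)‖e^{−½δ|x−x′|/s}` resp. `Σ_{x,x′,x″}η^{3d}‖φ′(x′)‖e^{−½δ|x−x′|/s}
e^{−½δ|x′−x″|/s}`.  Page 427 [PDF 17], verbatim: *"we use it [the exponential factor] to make the summation over Δ(v′). We get
some constant O(1) depending on δ₁ and n̄ only"*; pp. 438/442/444: *"a generalized expression of degree +α"*, *"the first term on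
the right side is convergent"*, *"This gives us a convergent expression"*.  WHAT IS HERE: the summation, by the volume-uniform
exponential sums of `B3TorusRadialSums.sum_exp_neg_tdist_le`: for `η ≤ s` (`s = L^jη`, `j ≥ 0`),
`Σ_{x′}η^d e^{−½δ(η·tdist(x,x′))/s} ≤ (2 + 4/δ)^d s^d` (`sum_vol_exp_le`), hence the two-point majorant is
`≤ (2 + 4/δ)^d s^d·Σ_xη^d‖φ(x)‖` (`sum_majorant2_le`) and the three-point one `≤ ((2 + 4/δ)^d s^d)²·Σ_{x′}η^d‖φ′(x′)‖`
(`sum_majorant3_le`); consequently `|(3.19)| ≤ K·H·(1 + 2/δ)(2 + 4/δ)^d·s^α s^d·‖φ‖₁` (`abs_subtracted319_le_norm`), the first term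
of (3.31) `≤ d·K₀·H·(1 + 2/δ)(2 + 4/δ)^d·s^α s^d·‖gA‖₁` (`abs_first331_le_norm`) and the convergent part of (3.34)
`≤ d·K·(H₁B₂ + B₁H₂)(1 + 2/δ)(2 + 4/δ)^{2d}·s^α s^{2d}·‖φ′‖₁` (`abs_convergent334_le_norm`), all uniform in the size of the torus
(`‖f‖₁ = Σ_xη^d|f(x)|`).  Hypotheses as in the two parent files (kernel bounds of (2.10) type are assumptions, not asserted).
Unit `lit-balaban-p20` (literature-prover-lit-balaban-p20-g3-0), 2026-08-21; HOME `run/shared/lean/pub/lit-balaban/` (FILED.md).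
-/

open scoped BigOperators RealInnerProductSpace

namespace Literature.MathematicalPhysics.QuantumFieldTheory.Balaban1983to89.B3AlphaGainSummed

open LatticeFieldCalculus B3Sect3ScalarSelfEnergy B3Sect3VectorSelfEnergy B3Sect3Subtraction319 B3Sect3TriangleGraphs
  B3SubtractionAlphaGain B3TriangleAlphaGain B3TorusRadialSums

noncomputable section

variable {P : Params} {j : ℕ}

/-! ## 1. The volume sum of half an exponential factor -/

/-- the ℓ¹ torus distance is symmetric. [folklore] -/
private theorem tdist_comm (x y : Site P j) : Site.tdist x y = Site.tdist y x := by
  unfold Site.tdist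
  exact Finset.sum_congr rfl fun μ _ => min_comm _ _

/-- **p. 427 [PDF 17] "we use it to make the summation … some constant O(1)"**, at scale `s`: for `0 < η ≤ s` and `δ > 0`,
`Σ_{x′∈T}η^d e^{−½δ(η·tdist(x,x′))/s} ≤ (2 + 4/δ)^d·s^d`, uniformly in the size of the torus (from
`B3TorusRadialSums.sum_exp_neg_tdist_le` with `a = ½δη/s`: `η·2(1 + a⁻¹) = 2η + 4s/δ ≤ (2 + 4/δ)s`). [cite: Balaban1983Higgs3, (2.15) p.427] -/
theorem sum_vol_exp_le {η s δ : ℝ} (hη : 0 < η) (hηs : η ≤ s) (hδ : 0 < δ) (x : Site P j) :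
    ∑ x' : Site P j, η ^ P.d * Real.exp (-(δ / 2 * s⁻¹ * (η * Site.tdist x x'))) ≤ (2 + 4 / δ) ^ P.d * s ^ P.d := by
  have hs : 0 < s := lt_of_lt_of_le hη hηs
  set a : ℝ := δ / 2 * s⁻¹ * η with ha
  have ha0 : 0 < a := by positivity
  have hsum := sum_exp_neg_tdist_le ha0 x
  have hre : ∀ x' : Site P j, Real.exp (-(δ / 2 * s⁻¹ * (η * Site.tdist x x'))) = Real.exp (-(a * (Site.tdist x x' : ℝ))) := by
    intro x'
    congr 1
    rw [ha]
    ring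
  simp only [hre, ← Finset.mul_sum]
  have hainv : a⁻¹ = 2 * s / (δ * η) := by
    rw [ha]
    field_simp
  have hstep : η * (2 * (1 + a⁻¹)) ≤ (2 + 4 / δ) * s := by
    rw [hainv]
    have h1 : η * (2 * (1 + 2 * s / (δ * η))) = 2 * η + 4 * s / δ := by
      field_simp
      ring
    rw [h1]
    have h2 : (2 + 4 / δ) * s = 2 * s + 4 * s / δ := by ring
    rw [h2]
    linarith
  calc η ^ P.d * ∑ x' : Site P j, Real.exp (-(a * (Site.tdist x x' : ℝ)))
      ≤ η ^ P.d * (2 * (1 + a⁻¹)) ^ P.d := mul_le_mul_of_nonneg_left hsum (by positivity)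
    _ = (η * (2 * (1 + a⁻¹))) ^ P.d := by rw [← mul_pow]
    _ ≤ ((2 + 4 / δ) * s) ^ P.d := pow_le_pow_left₀ (by positivity) hstep _
    _ = (2 + 4 / δ) ^ P.d * s ^ P.d := by rw [mul_pow]

/-- kernel: the two-point majorant summed — `Σ_{x,x′}η^{2d}f(x)e^{−½δ(η·tdist(x,x′))/s} ≤ (2 + 4/δ)^d s^d·Σ_xη^d f(x)` for `f ≥ 0`,
`0 < η ≤ s`. [cite: Balaban1983Higgs3, (2.15) p.427] -/
theorem sum_majorant2_le {η s δ : ℝ} (hη : 0 < η) (hηs : η ≤ s) (hδ : 0 < δ) (f : Site P j → ℝ) (hf : ∀ x, 0 ≤ f x) :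
    ∑ x : Site P j, ∑ x' : Site P j, η ^ (2 * P.d) * (f x * Real.exp (-(δ / 2 * s⁻¹ * (η * Site.tdist x x')))) ≤
      (2 + 4 / δ) ^ P.d * s ^ P.d * ∑ x : Site P j, η ^ P.d * f x := by
  have h2d : η ^ (2 * P.d) = η ^ P.d * η ^ P.d := by rw [two_mul, pow_add]
  have hx : ∀ x : Site P j, ∑ x' : Site P j, η ^ (2 * P.d) * (f x * Real.exp (-(δ / 2 * s⁻¹ * (η * Site.tdist x x')))) ≤
      (2 + 4 / δ) ^ P.d * s ^ P.d * (η ^ P.d * f x) := by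
    intro x
    have hre : ∑ x' : Site P j, η ^ (2 * P.d) * (f x * Real.exp (-(δ / 2 * s⁻¹ * (η * Site.tdist x x')))) =
        η ^ P.d * f x * ∑ x' : Site P j, η ^ P.d * Real.exp (-(δ / 2 * s⁻¹ * (η * Site.tdist x x'))) := by
      rw [Finset.mul_sum]
      exact Finset.sum_congr rfl fun x' _ => by rw [h2d]; ring
    rw [hre]
    calc η ^ P.d * f x * ∑ x' : Site P j, η ^ P.d * Real.exp (-(δ / 2 * s⁻¹ * (η * Site.tdist x x')))
        ≤ η ^ P.d * f x * ((2 + 4 / δ) ^ P.d * s ^ P.d) :=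
          mul_le_mul_of_nonneg_left (sum_vol_exp_le hη hηs hδ x) (mul_nonneg (by positivity) (hf x))
      _ = (2 + 4 / δ) ^ P.d * s ^ P.d * (η ^ P.d * f x) := by ring
  calc ∑ x : Site P j, ∑ x' : Site P j, η ^ (2 * P.d) * (f x * Real.exp (-(δ / 2 * s⁻¹ * (η * Site.tdist x x'))))
      ≤ ∑ x : Site P j, (2 + 4 / δ) ^ P.d * s ^ P.d * (η ^ P.d * f x) := Finset.sum_le_sum fun x _ => hx x
    _ = (2 + 4 / δ) ^ P.d * s ^ P.d * ∑ x : Site P j, η ^ P.d * f x := by rw [Finset.mul_sum]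

/-- kernel: the three-point majorant summed — `Σ_{x,x′,x″}η^{3d}f(x′)e^{−½δ(η·tdist(x,x′))/s}e^{−½δ(η·tdist(x′,x″))/s} ≤
((2 + 4/δ)^d s^d)²·Σ_{x′}η^d f(x′)` for `f ≥ 0`, `0 < η ≤ s`. [cite: Balaban1983Higgs3, (2.15) p.427] -/
theorem sum_majorant3_le {η s δ : ℝ} (hη : 0 < η) (hηs : η ≤ s) (hδ : 0 < δ) (f : Site P j → ℝ) (hf : ∀ x, 0 ≤ f x) :
    ∑ x : Site P j, ∑ x' : Site P j, ∑ x'' : Site P j, η ^ (3 * P.d) * (f x' *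
        (Real.exp (-(δ / 2 * s⁻¹ * (η * Site.tdist x x'))) * Real.exp (-(δ / 2 * s⁻¹ * (η * Site.tdist x' x''))))) ≤
      ((2 + 4 / δ) ^ P.d * s ^ P.d) ^ 2 * ∑ x' : Site P j, η ^ P.d * f x' := by
  set C : ℝ := (2 + 4 / δ) ^ P.d * s ^ P.d with hC
  have hC0 : 0 ≤ C := by
    have hs : 0 < s := lt_of_lt_of_le hη hηs
    positivity
  have h3d : η ^ (3 * P.d) = η ^ P.d * η ^ P.d * η ^ P.d := by
    rw [show 3 * P.d = P.d + P.d + P.d by ring, pow_add, pow_add]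
  -- the sums over x and x″ factor at fixed x′
  have hE1 : ∀ x' : Site P j, ∑ x : Site P j, η ^ P.d * Real.exp (-(δ / 2 * s⁻¹ * (η * Site.tdist x x'))) ≤ C := by
    intro x'
    have h := sum_vol_exp_le (P := P) (j := j) hη hηs hδ x'
    simp only [tdist_comm x'] at h
    exact h
  have hE2 : ∀ x' : Site P j, ∑ x'' : Site P j, η ^ P.d * Real.exp (-(δ / 2 * s⁻¹ * (η * Site.tdist x' x''))) ≤ C :=
    fun x' => sum_vol_exp_le hη hηs hδ x'
  rw [Finset.sum_comm]
  have hx' : ∀ x' : Site P j, ∑ x : Site P j, ∑ x'' : Site P j, η ^ (3 * P.d) * (f x' *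
      (Real.exp (-(δ / 2 * s⁻¹ * (η * Site.tdist x x'))) * Real.exp (-(δ / 2 * s⁻¹ * (η * Site.tdist x' x''))))) ≤
      C ^ 2 * (η ^ P.d * f x') := by
    intro x'
    have hre : ∑ x : Site P j, ∑ x'' : Site P j, η ^ (3 * P.d) * (f x' *
        (Real.exp (-(δ / 2 * s⁻¹ * (η * Site.tdist x x'))) * Real.exp (-(δ / 2 * s⁻¹ * (η * Site.tdist x' x''))))) =
        η ^ P.d * f x' * ((∑ x : Site P j, η ^ P.d * Real.exp (-(δ / 2 * s⁻¹ * (η * Site.tdist x x')))) *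
          ∑ x'' : Site P j, η ^ P.d * Real.exp (-(δ / 2 * s⁻¹ * (η * Site.tdist x' x'')))) := by
      rw [Finset.sum_mul_sum, Finset.mul_sum]
      refine Finset.sum_congr rfl fun x _ => ?_
      rw [Finset.mul_sum]
      exact Finset.sum_congr rfl fun x'' _ => by rw [h3d]; ring
    rw [hre]
    have hprod : (∑ x : Site P j, η ^ P.d * Real.exp (-(δ / 2 * s⁻¹ * (η * Site.tdist x x')))) *
        ∑ x'' : Site P j, η ^ P.d * Real.exp (-(δ / 2 * s⁻¹ * (η * Site.tdist x' x''))) ≤ C * C :=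
      mul_le_mul (hE1 x') (hE2 x') (Finset.sum_nonneg fun _ _ => by positivity) hC0
    calc η ^ P.d * f x' * ((∑ x : Site P j, η ^ P.d * Real.exp (-(δ / 2 * s⁻¹ * (η * Site.tdist x x')))) *
          ∑ x'' : Site P j, η ^ P.d * Real.exp (-(δ / 2 * s⁻¹ * (η * Site.tdist x' x''))))
        ≤ η ^ P.d * f x' * (C * C) := mul_le_mul_of_nonneg_left hprod (mul_nonneg (by positivity) (hf x'))
      _ = C ^ 2 * (η ^ P.d * f x') := by ring
  calc ∑ x' : Site P j, ∑ x : Site P j, ∑ x'' : Site P j, η ^ (3 * P.d) * (f x' *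
          (Real.exp (-(δ / 2 * s⁻¹ * (η * Site.tdist x x'))) * Real.exp (-(δ / 2 * s⁻¹ * (η * Site.tdist x' x'')))))
      ≤ ∑ x' : Site P j, C ^ 2 * (η ^ P.d * f x') := Finset.sum_le_sum fun x' _ => hx' x'
    _ = C ^ 2 * ∑ x' : Site P j, η ^ P.d * f x' := by rw [Finset.mul_sum]

/-! ## 2. The summed degree-`+α` bounds -/

section Eq319

variable {W : Type*} [NormedAddCommGroup W] [InnerProductSpace ℝ W]

/-- **(3.19) p. 438 "of degree +α", summed over the torus — PROVED.**  Under the hypotheses of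
`B3SubtractionAlphaGain.abs_subtracted319_le` and `η ≤ s`:
`|Σ_{x,x′}η^{2d}φ(x)·Σ(x,x′)φ′(x′) − Σ_xη^dφ(x)·(Σ_{x′}η^dΣ(x,x′))φ′(x)| ≤ K·H·(1 + 2/δ)·(2 + 4/δ)^d·s^α·s^d·Σ_xη^d‖φ(x)‖`,
uniformly in the volume. [cite: Balaban1983Higgs3, (3.19) p.438] -/
theorem abs_subtracted319_le_norm (η : ℝ) (hη : 0 < η) {α H K δ s : ℝ} (hα0 : 0 ≤ α) (hα1 : α ≤ 1) (hH : 0 ≤ H)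
    (hK : 0 ≤ K) (hδ : 0 < δ) (hηs : η ≤ s) (Sg : Site P j → Site P j → W →ₗ[ℝ] W) (φ φ' : SiteField P j W)
    (hSg : ∀ (x x' : Site P j) (v : W), ‖Sg x x' v‖ ≤ K * Real.exp (-(δ * s⁻¹ * (η * Site.tdist x x'))) * ‖v‖)
    (hφ' : ∀ x x' : Site P j, ‖φ' x' - φ' x‖ ≤ H * (η * Site.tdist x x') ^ α) :
    |subtracted319 η Sg φ φ'| ≤
      K * H * (1 + 2 / δ) * (2 + 4 / δ) ^ P.d * s ^ α * s ^ P.d * ∑ x : Site P j, η ^ P.d * ‖φ x‖ := by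
  have hs : 0 < s := lt_of_lt_of_le hη hηs
  have h1 := abs_subtracted319_le η hη hα0 hα1 hH hK hδ hs Sg φ φ' hSg hφ'
  have h2 := sum_majorant2_le (P := P) (j := j) hη hηs hδ (fun x => ‖φ x‖) fun x => norm_nonneg _
  calc |subtracted319 η Sg φ φ'|
      ≤ K * H * (1 + 2 / δ) * s ^ α * ∑ x : Site P j, ∑ x' : Site P j,
          η ^ (2 * P.d) * (‖φ x‖ * Real.exp (-(δ / 2 * s⁻¹ * (η * Site.tdist x x')))) := h1
    _ ≤ K * H * (1 + 2 / δ) * s ^ α * ((2 + 4 / δ) ^ P.d * s ^ P.d * ∑ x : Site P j, η ^ P.d * ‖φ x‖) :=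
        mul_le_mul_of_nonneg_left h2 (by positivity)
    _ = _ := by ring

end Eq319

/-- **(3.31) p. 442 "the first term on the right side is convergent", summed over the torus — PROVED.**  Under the hypotheses
of `B3SubtractionAlphaGain.abs_first331_le` and `η ≤ s`, r15's typed first term of (3.31) is at most
`d·K₀·H·(1 + 2/δ)·(2 + 4/δ)^d·s^α·s^d·Σ_xη^dΣ_μ|g(x)A_μ(x)|`, uniformly in the volume. [cite: Balaban1983Higgs3, (3.31) p.442] -/
theorem abs_first331_le_norm (η α : ℝ) (hη : 0 < η) {H K₀ δ s : ℝ} (hα0 : 0 ≤ α) (hα1 : α ≤ 1) (hH : 0 ≤ H)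
    (hK : 0 ≤ K₀) (hδ : 0 < δ) (hηs : η ≤ s) (K : Fin P.d → Fin P.d → Kernel P j) (g g' : SiteField P j ℝ)
    (A A' : VecField P j ℝ)
    (hKb : ∀ (μ μ' : Fin P.d) (x x' : Site P j), |K μ μ' x x'| ≤ K₀ * Real.exp (-(δ * s⁻¹ * (η * Site.tdist x x'))))
    (hφ' : ∀ (μ' : Fin P.d) (x x' : Site P j),
      |g' x' * A' ⟨x', μ'⟩ - g' x * A' ⟨x, μ'⟩| ≤ H * (η * Site.tdist x x') ^ α) :
    |pairSum η K g A (fun μ' x x' => (η * supDist x x') ^ α *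
        ((g' x' * A' ⟨x', μ'⟩ - g' x * A' ⟨x, μ'⟩) / (η * supDist x x') ^ α))| ≤
      P.d * K₀ * H * (1 + 2 / δ) * (2 + 4 / δ) ^ P.d * s ^ α * s ^ P.d *
        ∑ x : Site P j, η ^ P.d * ∑ μ : Fin P.d, |g x * A ⟨x, μ⟩| := by
  have hs : 0 < s := lt_of_lt_of_le hη hηs
  have h1 := abs_first331_le η α hη hα0 hα1 hH hK hδ hs K g g' A A' hKb hφ'
  have h2 := sum_majorant2_le (P := P) (j := j) hη hηs hδ (fun x => ∑ μ : Fin P.d, |g x * A ⟨x, μ⟩|)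
    fun x => Finset.sum_nonneg fun _ _ => abs_nonneg _
  calc |pairSum η K g A (fun μ' x x' => (η * supDist x x') ^ α *
          ((g' x' * A' ⟨x', μ'⟩ - g' x * A' ⟨x, μ'⟩) / (η * supDist x x') ^ α))|
      ≤ P.d * K₀ * H * (1 + 2 / δ) * s ^ α * ∑ x : Site P j, ∑ x' : Site P j, η ^ (2 * P.d) *
          ((∑ μ : Fin P.d, |g x * A ⟨x, μ⟩|) * Real.exp (-(δ / 2 * s⁻¹ * (η * Site.tdist x x')))) := h1
    _ ≤ P.d * K₀ * H * (1 + 2 / δ) * s ^ α *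
          ((2 + 4 / δ) ^ P.d * s ^ P.d * ∑ x : Site P j, η ^ P.d * ∑ μ : Fin P.d, |g x * A ⟨x, μ⟩|) :=
        mul_le_mul_of_nonneg_left h2 (by positivity)
    _ = _ := by ring

section Eq334

variable {W : Type*} [NormedAddCommGroup W] [InnerProductSpace ℝ W]

/-- **(3.34) p. 444 "This gives us a convergent expression", summed over the torus — PROVED.**  Under the hypotheses of
`B3TriangleAlphaGain.abs_convergent334_le` and `η ≤ s`, the two transported terms of (3.34) are at most
`d·K·(H₁B₂ + B₁H₂)·(1 + 2/δ)·((2 + 4/δ)^d s^d)²·s^α·Σ_{x′}η^d‖φ′(x′)‖`, uniformly in the volume. [cite: Balaban1983Higgs3, (3.34) p.444] -/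
theorem abs_convergent334_le_norm (η α : ℝ) (hη : 0 < η) {H₁ H₂ B₁ B₂ K δ s : ℝ} (hα0 : 0 ≤ α) (hα1 : α ≤ 1)
    (hH₁ : 0 ≤ H₁) (hH₂ : 0 ≤ H₂) (hB₁ : 0 ≤ B₁) (hB₂ : 0 ≤ B₂) (hK : 0 ≤ K) (hδ : 0 < δ) (hηs : η ≤ s)
    (Γ : Kernel3 P j W) (g : SiteField P j ℝ) (A : VecField P j ℝ) (φ' φ'' : SiteField P j W)
    (hΓ : ∀ (μ : Fin P.d) (x x' x'' : Site P j) (v : W), ‖Γ μ x x' x'' v‖ ≤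
      K * Real.exp (-(δ * s⁻¹ * (η * Site.tdist x x'))) * Real.exp (-(δ * s⁻¹ * (η * Site.tdist x' x''))) * ‖v‖)
    (hgAH : ∀ (μ : Fin P.d) (x x' : Site P j), |g x * A ⟨x, μ⟩ - g x' * A ⟨x', μ⟩| ≤ H₁ * (η * Site.tdist x x') ^ α)
    (hgAB : ∀ (μ : Fin P.d) (x' : Site P j), |g x' * A ⟨x', μ⟩| ≤ B₁)
    (hφ''H : ∀ x' x'' : Site P j, ‖φ'' x'' - φ'' x'‖ ≤ H₂ * (η * Site.tdist x' x'') ^ α)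
    (hφ''B : ∀ x'' : Site P j, ‖φ'' x''‖ ≤ B₂) :
    |tripleSum η Γ (fun μ x x' => (g x * A ⟨x, μ⟩ - g x' * A ⟨x', μ⟩) / (η * supDist x x') ^ α) φ'
          (fun x x' x'' => (η * supDist x x') ^ α • φ'' x'') +
        tripleSum η Γ (fun μ _ x' => g x' * A ⟨x', μ⟩) φ'
          (fun _ x' x'' => (η * supDist x'' x') ^ α • (((η * supDist x'' x') ^ α)⁻¹ • (φ'' x'' - φ'' x')))| ≤
      P.d * (K * (H₁ * B₂ + B₁ * H₂) * (1 + 2 / δ) * s ^ α) * ((2 + 4 / δ) ^ P.d * s ^ P.d) ^ 2 *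
        ∑ x' : Site P j, η ^ P.d * ‖φ' x'‖ := by
  have hs : 0 < s := lt_of_lt_of_le hη hηs
  have h1 := abs_convergent334_le η α hη hα0 hα1 hH₁ hH₂ hB₁ hB₂ hK hδ hs Γ g A φ' φ'' hΓ hgAH hgAB hφ''H hφ''B
  have h2 := sum_majorant3_le (P := P) (j := j) hη hηs hδ (fun x' => ‖φ' x'‖) fun x => norm_nonneg _
  calc _ ≤ P.d * (K * (H₁ * B₂ + B₁ * H₂) * (1 + 2 / δ) * s ^ α) *
          ∑ x : Site P j, ∑ x' : Site P j, ∑ x'' : Site P j, η ^ (3 * P.d) * (‖φ' x'‖ *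
            (Real.exp (-(δ / 2 * s⁻¹ * (η * Site.tdist x x'))) * Real.exp (-(δ / 2 * s⁻¹ * (η * Site.tdist x' x''))))) := h1
    _ ≤ P.d * (K * (H₁ * B₂ + B₁ * H₂) * (1 + 2 / δ) * s ^ α) *
          (((2 + 4 / δ) ^ P.d * s ^ P.d) ^ 2 * ∑ x' : Site P j, η ^ P.d * ‖φ' x'‖) :=
        mul_le_mul_of_nonneg_left h2 (by positivity)
    _ = _ := by ring

end Eq334

end

end Literature.MathematicalPhysics.QuantumFieldTheory.Balaban1983to89.B3AlphaGainSummed
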